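import Summits.AnomalousDissipation.AnomalousDissipation.Theorems.SolenoidalFractalHomogenisationLagrangianStepSidebandXEffGen
import Literature.Analysis.FluidPDE.PassiveVectorTensorUniqueness
import HarnessLib

/-!
# K1L_D `LagrangianRenormalisationStepDesign` (stmt-AnomalousDissipation-27980), `stub_D1_V0R` (ruling D27-1), brick T8a-3: ONE-SIDED COERCIVITY of the
# augmented effective generator from a LOWER transverse bound only, and the lower transverse bound of the effective cell tensor
# `(1/n²)•(𝔸 + (1/ν)•psiStar)` from those of `𝔸` and `psiStar` (helper; `--kind proof --supports stmt-AnomalousDissipation-27980 --as helper`)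

Summits-side helper file of route `SolenoidalFractalHomogenisation` (prover seat `ad-k1l-cellLawV-w1` g7; 0 sorry, no defs, no named facts).
`…SidebandXEffGen.effGenC_coercive` needs a two-sided `NearIso` window for the effective tensor; the residue hypothesis of `stub_D1_V0R` delivers a LOWER
bound for the symbol of `psiStar` (`…SidebandXPsiStarLower`, `…SidebandXGainFormLower`), which is all coercivity needs:
* `lo_mul_le_re_inner_symbT_of_lower` — `lo'|k|²‖z‖² ≤ Re⟪z, T_𝔸(k) z⟫` for transversal complex `z` from the lower half only (copy of Literature
  `PassiveVectorTensorUniqueness.lo_mul_le_re_inner_symbT`);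
* **`effGenC_coercive_of_lower`** — `(∀ p ⊥ k, lo'(Σk²)(Σp²) ≤ symb 𝔹' k p)`, `lo' ≥ 0` ⇒ `4π²lo'|ℓ|²‖v‖² ≤ ⟪effGenC 𝔹' ℓ (4π²lo'|ℓ|²) v, v⟫_ℝ` on `ℂ³`;
* **`symb_effTensor_ge`** — lower bounds `lo𝔸` for `𝔸` and `cψ` for `Ψ` give `(1/n²)(lo𝔸 + cψ/ν)` for `(1/n²)•(𝔸 + (1/ν)•Ψ)` (`ν > 0`).
NOT a proof of any registered stub, of K1L_D, or of anomalous dissipation; rung F-D1.A0 infrastructure.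
-/

set_option linter.dupNamespace false

noncomputable section

namespace Summit.AnomalousDissipation.AnomalousDissipation.Theorems.SolenoidalFractalHomogenisation.LagrangianStep.Sideband

open Set MeasureTheory Complex UnitAddTorus
open scoped InnerProductSpace
open Literature.Analysis Literature.Analysis.FunctionSpaces Literature.Analysis.FunctionSpaces.Torus
open Literature.Analysis.FluidPDE Literature.Analysis.FluidPDE.Torus Literature.Analysis.FluidPDE.LatticeShear
open Summit.AnomalousDissipation.AnomalousDissipation.Theorems.SolenoidalFractalHomogenisation.LagrangianStep.CellChain (norm_transversalProj_le)

/-! ## §1 Lower transverse bound ⇒ coercivity on transversal complex vectors -/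

/-- Transversality of a complex vector passes to its real and imaginary parts. [folklore] -/
theorem sum_re_im_mul_eq_zero_of_transversal {k : Fin 3 → ℤ} {z : EuclideanSpace ℂ (Fin 3)} (hz : ∑ j, (k j : ℂ) * z j = 0) :
    ∑ i, (z i).re * (k i : ℝ) = 0 ∧ ∑ i, (z i).im * (k i : ℝ) = 0 := by
  have hre := congrArg Complex.re hz
  have him := congrArg Complex.im hz
  rw [Complex.re_sum, Complex.zero_re] at hre
  rw [Complex.im_sum, Complex.zero_im] at him
  constructor
  · rw [← hre]
    refine Finset.sum_congr rfl fun i _ => ?_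
    rw [← Complex.ofReal_intCast, Complex.re_ofReal_mul, mul_comm]
  · rw [← him]
    refine Finset.sum_congr rfl fun i _ => ?_
    rw [← Complex.ofReal_intCast, Complex.im_ofReal_mul, mul_comm]

/-- **Lower Legendre–Hadamard bound, complexified, one-sided**: `(∀ p ⊥ k, lo'(Σk²)(Σp²) ≤ symb 𝔸 k p)` and `k·z = 0` give
`lo'|k|²‖z‖² ≤ Re⟪z, T_𝔸(k) z⟫`. [cite: Giaquinta1983MultipleIntegrals, Ch. III §2 eq. (2.2)] -/
theorem lo_mul_le_re_inner_symbT_of_lower {𝔸 : Torus.Visc4 (Fin 3)} {lo' : ℝ}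
    (hlow : ∀ k p : Fin 3 → ℝ, ∑ i, p i * k i = 0 → lo' * ((∑ a, k a ^ 2) * (∑ i, p i ^ 2)) ≤ Torus.symb 𝔸 k p)
    {k : Fin 3 → ℤ} {z : EuclideanSpace ℂ (Fin 3)} (hz : ∑ j, (k j : ℂ) * z j = 0) :
    lo' * (freqNormSq k * ‖z‖ ^ 2) ≤ (⟪z, Torus.symbT 𝔸 k z⟫_ℂ).re := by
  obtain ⟨hre, him⟩ := sum_re_im_mul_eq_zero_of_transversal hz
  have h1 := hlow (fun a => (k a : ℝ)) (fun i => (z i).re) hre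
  have h2 := hlow (fun a => (k a : ℝ)) (fun i => (z i).im) him
  have hnorm : ‖z‖ ^ 2 = ∑ i, (z i).re ^ 2 + ∑ i, (z i).im ^ 2 := by
    rw [EuclideanSpace.norm_sq_eq, ← Finset.sum_add_distrib]
    refine Finset.sum_congr rfl fun i _ => ?_
    rw [Complex.sq_norm, Complex.normSq_apply]
    ring
  rw [Torus.re_inner_symbT_eq, hnorm, freqNormSq]
  nlinarith [h1, h2]

/-- **COERCIVITY OF THE AUGMENTED EFFECTIVE GENERATOR FROM THE LOWER BOUND ONLY**: if `lo'(Σk²)(Σp²) ≤ symb 𝔹' k p` for all `p ⊥ k` and `lo' ≥ 0`, then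
with `r₁ := 4π²lo'|ℓ|²`, `4π²lo'|ℓ|²‖v‖² ≤ ⟪effGenC 𝔹' ℓ r₁ v, v⟫_ℝ` for every `v ∈ ℂ³`. [cite: Frisch1995Turbulence, §9.6.3 eq. (9.57) p. 233]
[cite: Giaquinta1983MultipleIntegrals, Ch. III §2 eq. (2.2)] -/
theorem effGenC_coercive_of_lower {𝔹' : Torus.Visc4 (Fin 3)} {lo' : ℝ}
    (hlow : ∀ k p : Fin 3 → ℝ, ∑ i, p i * k i = 0 → lo' * ((∑ a, k a ^ 2) * (∑ i, p i ^ 2)) ≤ Torus.symb 𝔹' k p) (hlo' : 0 ≤ lo')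
    (ℓ : Fin 3 → ℤ) (v : EuclideanSpace ℂ (Fin 3)) :
    4 * Real.pi ^ 2 * lo' * freqNormSq ℓ * ‖v‖ ^ 2 ≤ ⟪effGenC 𝔹' ℓ (4 * Real.pi ^ 2 * lo' * freqNormSq ℓ) v, v⟫_ℝ := by
  rw [real_inner_effGenC]
  have hlowT : ∀ k p : Fin 3 → ℝ, ∑ i, p i * k i = 0 → lo' * ((∑ a, k a ^ 2) * (∑ i, p i ^ 2)) ≤ Torus.symb (Torus.majorTranspose 𝔹') k p :=
    fun k p hkp => by rw [Torus.symb_majorTranspose]; exact hlow k p hkp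
  set w := transversalProj ℓ v with hw_def
  have hw : kdot ℓ w = 0 := CellChain.kdot_transversalProj' ℓ v
  have hz : ∑ j, (ℓ j : ℂ) * w j = 0 := by rw [← kdot_apply]; exact hw
  have h1 : 4 * Real.pi ^ 2 * lo' * (freqNormSq ℓ * ‖w‖ ^ 2) ≤ (⟪Torus.modalAdjGen (Torus.majorTranspose 𝔹') ℓ w, w⟫_ℂ).re := by
    have hsym : (⟪Torus.modalAdjGen (Torus.majorTranspose 𝔹') ℓ w, w⟫_ℂ).re = (⟪w, Torus.modalAdjGen (Torus.majorTranspose 𝔹') ℓ w⟫_ℂ).re := by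
      rw [← inner_conj_symm, Complex.conj_re]
    rw [hsym, Torus.re_inner_modalAdjGen_self _ ℓ hw]
    have h := lo_mul_le_re_inner_symbT_of_lower hlowT hz
    have hpi : 0 ≤ 4 * Real.pi ^ 2 := by positivity
    nlinarith [mul_le_mul_of_nonneg_left h hpi]
  have hP : ‖w‖ ^ 2 ≤ ‖v‖ ^ 2 := pow_le_pow_left₀ (norm_nonneg _) (norm_transversalProj_le ℓ v) 2
  have hc : 0 ≤ 4 * Real.pi ^ 2 * lo' * freqNormSq ℓ := by
    have := freqNormSq_nonneg ℓ; positivity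
  nlinarith [h1, hP, hc, mul_nonneg hc (sub_nonneg.2 hP)]

/-! ## §2 The lower transverse bound of the effective cell tensor -/

/-- **Lower transverse bound of `(1/n²)•(𝔸 + (1/ν)•Ψ)`** from lower bounds `lo𝔸` of `𝔸` and `cψ` of `Ψ` (`ν > 0`):
`(1/n²)(lo𝔸 + cψ/ν)(Σk²)(Σp²) ≤ symb ((1/n²)•(𝔸 + (1/ν)•Ψ)) k p` for `p ⊥ k`. [cite: Giaquinta1983MultipleIntegrals, Ch. III §2 eq. (2.2)] -/
theorem symb_effTensor_ge {𝔸 Ψ : Torus.Visc4 (Fin 3)} {loA cψ ν : ℝ} (hν : 0 < ν) (n : ℕ)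
    (hA : ∀ k p : Fin 3 → ℝ, ∑ i, p i * k i = 0 → loA * ((∑ a, k a ^ 2) * (∑ i, p i ^ 2)) ≤ Torus.symb 𝔸 k p)
    (hΨ : ∀ k p : Fin 3 → ℝ, ∑ i, p i * k i = 0 → cψ * ((∑ a, k a ^ 2) * (∑ i, p i ^ 2)) ≤ Torus.symb Ψ k p)
    (k p : Fin 3 → ℝ) (hkp : ∑ i, p i * k i = 0) :
    (1 / (n : ℝ) ^ 2 * (loA + cψ / ν)) * ((∑ a, k a ^ 2) * (∑ i, p i ^ 2)) ≤
      Torus.symb ((1 / (n : ℝ) ^ 2) • (𝔸 + (1 / ν) • Ψ)) k p := by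
  rw [Torus.symb_smul, Torus.symb_add, Torus.symb_smul]
  have h1 := hA k p hkp
  have h2 := hΨ k p hkp
  have hn : (0 : ℝ) ≤ 1 / (n : ℝ) ^ 2 := by positivity
  have hν' : 0 < 1 / ν := by positivity
  have h3 : (loA + cψ / ν) * ((∑ a, k a ^ 2) * (∑ i, p i ^ 2)) ≤ Torus.symb 𝔸 k p + 1 / ν * Torus.symb Ψ k p := by
    have := mul_le_mul_of_nonneg_left h2 hν'.le
    have e : 1 / ν * (cψ * ((∑ a, k a ^ 2) * ∑ i, p i ^ 2)) = cψ / ν * ((∑ a, k a ^ 2) * ∑ i, p i ^ 2) := by ring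
    rw [e] at this
    linarith
  calc 1 / (n : ℝ) ^ 2 * (loA + cψ / ν) * ((∑ a, k a ^ 2) * ∑ i, p i ^ 2)
      = 1 / (n : ℝ) ^ 2 * ((loA + cψ / ν) * ((∑ a, k a ^ 2) * ∑ i, p i ^ 2)) := by ring
    _ ≤ 1 / (n : ℝ) ^ 2 * (Torus.symb 𝔸 k p + 1 / ν * Torus.symb Ψ k p) := mul_le_mul_of_nonneg_left h3 hn

end Summit.AnomalousDissipation.AnomalousDissipation.Theorems.SolenoidalFractalHomogenisation.LagrangianStep.Sideband

end
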